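import Literature.Computability.MetaComplexity.SmolenskyCorrelationRestrict
import Literature.Computability.Complexity.VaziraniXorLemma
import HarnessLib

/-!
# Parallel repetition: `r` parity instances against `AC⁰[p]` circuits, `p` odd
# (the classical core of the `QNC⁰/qpoly ⊄ AC⁰[p]` separations)

The combinatorial-algebraic core of Grewal–Kumar 2024, Thm. 5.37 (for `AC⁰[p]`, i.e. `k = 1`,
without random advice) and of Watts–Kothari–Schaeffer–Tal 2019, §6: an input `x ∈ {0,1}ᴺ` carries
`r` pairwise disjoint BLOCKS `T_1, …, T_r ⊆ [N]` of at least `n ≥ 1` coordinates each, and `r`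
circuits `C_1, …, C_r` over `accBasis p = {¬, ∧ₖ, ∨ₖ, MOD_{p,k}}` (`p` an odd prime) of
`acDepth ≤ d` each try to output the parity of their block, `C_i(x) = ⊕_{j ∈ T_i} x_j`. Then
(`parallel_parity_correlation_bound`) the number of inputs on which at least `(1/2 + γ)·r` of
the `r` circuits are right is at most

  `(exp(-2γ²r) + (r·D/√n + (Σ_i size C_i)/p^ℓ) · √(2ʳ)) · 2ᴺ`,  `D = ((p-1)ℓ)^d`, any `ℓ ≥ 1`.

(For `r = Θ(log n)`, `ℓ = Θ(log n)`-ish and polynomial sizes this is `n^{-Ω(1)}·2ᴺ` — the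
printed "probability at most `n^{-Ω(1)}`".)

Proof (as printed, GK Thm. 5.37 / WKST §6): for every non-empty `S ⊆ [r]` the XOR
`⊕_{i∈S} C_i(x)` of the output wires agrees, off an exceptional set `E` with
`|E|·p^ℓ ≤ (Σ size)·2ᴺ`, with a polynomial of degree `≤ r·D` over `𝔽_p`
(`razborov_smolensky_postprocess`), hence agrees with the parity of the `S`-blocks
`⊕_{j ∈ ⋃_{i∈S} T_i} x_j` on at most `2^{N-m}(2^{m-1} + rD·C(m, m/2)) + |E|` inputs,
`m = Σ_{i∈S} |T_i| ≥ n` (`paritySubset_agreement_le`), and symmetrically for its negation; so the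
`±1`-bias of "an even number of the attempts in `S` err" is at most
`(2rD/√n + 2(Σ size)/p^ℓ)·2ᴺ` (`C(m, m/2) ≤ 2^m/√m`, `choose_half_le_two_pow_div_sqrt`);
Vazirani's XOR lemma with Hoeffding (`XorLemma.card_many_correct_le`) finishes.

Deliberately NOT here: the reduction from the `(q, r)`-Parallel Parity Bending relation
(composition with a `MOD_p` gate on each output block, GK Thm. 5.37 last paragraph), random
advice, `GC⁰(k)` gates, and the case `p = 2` (which needs `Σ xᵢ mod 3` on trits, GK §5.3).

## References

* S. Grewal, V. M. Kumar, *Improved circuit lower bounds and quantum-classical separations*,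
  arXiv:2408.16406 (2024), Thm. 5.37 (and Lemma 5.31, Cor. 5.36) [GrewalKumar2024].
* A. Bene Watts, R. Kothari, L. Schaeffer, A. Tal, *Exponential separation between shallow quantum
  circuits and unbounded fan-in shallow classical circuits*, STOC 2019, arXiv:1906.08890, §6
  [WattsEtAl2019].
* R. Smolensky, *Algebraic methods in the theory of lower bounds for Boolean circuit
  complexity*, STOC 1987 [Smolensky1987].
-/

noncomputable section

namespace Literature.Computability.MetaComplexity

open Finset Module Literature.Computability.Complexity

namespace Smolensky

open scoped Classical

/-! ### The middle binomial coefficient, every length -/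

/-- `C(n, n/2)² · n ≤ 4ⁿ` for EVERY `n` (odd `n`: `choose_half_sq_mul_le`; even `n = 2m`:
`(2m+1)·C(2m,m)² ≤ 16^m`, `succ_mul_centralBinom_sq_le`). [folklore] -/
private theorem choose_half_sq_mul_le' (n : ℕ) : n.choose (n / 2) ^ 2 * n ≤ 4 ^ n := by
  rcases Nat.even_or_odd n with ⟨m, rfl⟩ | hn
  · have h := succ_mul_centralBinom_sq_le m
    have hm : (m + m) / 2 = m := by omega
    rw [hm, show m + m = 2 * m by ring, ← Nat.centralBinom_eq_two_mul_choose]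
    calc Nat.centralBinom m ^ 2 * (2 * m) ≤ (2 * m + 1) * Nat.centralBinom m ^ 2 := by
          nlinarith [Nat.zero_le (Nat.centralBinom m ^ 2)]
      _ ≤ 16 ^ m := h
      _ = 4 ^ (2 * m) := by rw [pow_mul]; norm_num
  · exact choose_half_sq_mul_le hn

/-- **`C(n, n/2) ≤ 2ⁿ/√n`** for `n ≥ 1` (real form of `C(n,n/2)²·n ≤ 4ⁿ`). [folklore] -/
private theorem choose_half_le_two_pow_div_sqrt {n : ℕ} (hn : 1 ≤ n) :
    (n.choose (n / 2) : ℝ) ≤ 2 ^ n / Real.sqrt n := by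
  have h := choose_half_sq_mul_le' n
  have hn' : (0 : ℝ) < n := by exact_mod_cast hn
  rw [le_div_iff₀ (Real.sqrt_pos.2 hn')]
  have h2 : ((n.choose (n / 2) : ℝ) * Real.sqrt n) ^ 2 ≤ ((2 : ℝ) ^ n) ^ 2 := by
    rw [mul_pow, Real.sq_sqrt hn'.le, ← pow_mul,
      show (2 : ℝ) ^ (n * 2) = 4 ^ n by rw [mul_comm, pow_mul]; norm_num]
    exact_mod_cast h
  exact (pow_le_pow_iff_left₀ (by positivity) (by positivity) two_ne_zero).1 h2

/-! ### Parity bookkeeping on finite sets -/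

/-- A `±1`-product is `(-1)^{number of sign flips}`. [folklore] -/
private theorem prod_pm_eq_neg_one_pow {ι : Type*} (S : Finset ι) (b : ι → Bool) :
    ∏ i ∈ S, (if b i then (-1 : ℝ) else 1) = (-1) ^ (S.filter fun i => b i = true).card := by
  rw [Finset.prod_ite, Finset.prod_const_one, mul_one, Finset.prod_const]

/-- `(-1)^k` is `1` for even `k` and `-1` for odd `k`. [folklore] -/
private theorem neg_one_pow_eq_ite (k : ℕ) : (-1 : ℝ) ^ k = if k % 2 = 0 then 1 else -1 := by
  rcases Nat.even_or_odd k with hk | hk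
  · rw [hk.neg_one_pow, if_pos (Nat.even_iff.1 hk)]
  · rw [hk.neg_one_pow, if_neg (by rw [Nat.odd_iff.1 hk]; norm_num)]

/-- The number of positions where two bit vectors differ has the parity of the sum of their
weights. [folklore] -/
private theorem card_filter_ne_mod_two {ι : Type*} (S : Finset ι) (a b : ι → Bool) :
    (S.filter fun i => a i ≠ b i).card % 2 =
      ((S.filter fun i => a i = true).card + (S.filter fun i => b i = true).card) % 2 := by
  have key : ∀ i, (if a i ≠ b i then 1 else 0) + 2 * (if (a i = true ∧ b i = true) then 1 else 0)
      = (if a i = true then 1 else 0) + (if b i = true then 1 else 0) := by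
    intro i; cases a i <;> cases b i <;> simp
  have hsum := Finset.sum_congr rfl fun i (_ : i ∈ S) => key i
  rw [Finset.sum_add_distrib, Finset.sum_add_distrib, ← Finset.mul_sum] at hsum
  rw [Finset.card_filter, Finset.card_filter, Finset.card_filter]
  omega

/-- The number of odd summands has the parity of the sum. [folklore] -/
private theorem card_filter_odd_mod_two {ι : Type*} (S : Finset ι) (k : ι → ℕ) :
    (S.filter fun i => k i % 2 = 1).card % 2 = (∑ i ∈ S, k i) % 2 := by
  induction S using Finset.induction_on with
  | empty => simp
  | insert i S hi ih =>
    rw [Finset.sum_insert hi, Finset.filter_insert]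
    by_cases h : k i % 2 = 1
    · rw [if_pos h, Finset.card_insert_of_notMem (fun h' => hi (Finset.mem_of_mem_filter _ h'))]
      omega
    · rw [if_neg h]
      omega

/-! ### The parallel-repetition bound -/

variable {p : ℕ} [Fact p.Prime]

/-- **`r` parity instances against `AC⁰[p]` circuits, `p` odd — the classical core of the
`QNC⁰/qpoly ⊄ AC⁰[p]` separation** (Grewal–Kumar 2024, Thm. 5.37 with `k = 1` and no random
advice; Watts–Kothari–Schaeffer–Tal 2019, §6). Let `p` be an odd prime, `T_1, …, T_r ⊆ [N]`
pairwise disjoint blocks with `|T_i| ≥ n ≥ 1`, `C_1, …, C_r` circuits over `accBasis p` on the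
`N` inputs of `acDepth ≤ d`, `ℓ ≥ 1`, `D = ((p-1)ℓ)^d`, and `γ ≥ 0`. Then the number of inputs
`x ∈ {0,1}ᴺ` for which at least `(1/2 + γ)·r` indices `i` satisfy `C_i(x) = ⊕_{j ∈ T_i} x_j` is
at most `(exp(-2γ²r) + (r·D/√n + (Σ_i size C_i)/p^ℓ)·√(2ʳ))·2ᴺ`. (For each non-empty `S ⊆ [r]`
the XOR of the outputs over `S` is a degree-`rD` polynomial off a small set
(`razborov_smolensky_postprocess`), so its agreement AND disagreement with the `S`-block parity
are each at most `2ᴺ⁻¹ + 2ᴺ·rD/√n + (Σ size)·2ᴺ/p^ℓ` (`paritySubset_agreement_le`,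
`C(m,m/2) ≤ 2^m/√m`); this bounds every XOR-bias of the error vector, and
`XorLemma.card_many_correct_le` concludes.) [cite: GrewalKumar2024, Thm. 5.37] -/
theorem parallel_parity_correlation_bound (hp2 : p ≠ 2) {N r n d ℓ : ℕ} (hℓ : 1 ≤ ℓ)
    (hn : 1 ≤ n) (T : Fin r → Finset (Fin N))
    (hdisj : ∀ i j, i ≠ j → Disjoint (T i) (T j)) (hTn : ∀ i, n ≤ (T i).card)
    (C : Fin r → Circuit (Fin N)) (hC : ∀ i, (C i).IsOver (accBasis p))
    (hd : ∀ i, (C i).acDepth ≤ d) {γ : ℝ} (hγ : 0 ≤ γ) :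
    ((univ.filter fun x : Fin N → Bool =>
        (1 / 2 + γ) * r ≤ ((univ.filter fun i : Fin r =>
          (C i).eval x = decide (((T i).filter fun j => x j = true).card % 2 = 1)).card : ℝ)).card
        : ℝ) ≤
      (Real.exp (-(2 * γ ^ 2 * r)) +
          (((r * ((p - 1) * ℓ) ^ d : ℕ) : ℝ) / Real.sqrt n +
              ((∑ i, (C i).size : ℕ) : ℝ) / (p : ℝ) ^ ℓ) * Real.sqrt (2 ^ r)) * 2 ^ N := by
  have hp := (Fact.out : p.Prime)
  have h2F : (2 : ZMod p) ≠ 0 := by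
    intro h
    have h' : ((2 : ℕ) : ZMod p) = 0 := by exact_mod_cast h
    rw [ZMod.natCast_eq_zero_iff] at h'
    exact hp2 ((Nat.prime_dvd_prime_iff_eq hp Nat.prime_two).1 h')
  -- notation
  set D : ℕ := ((p - 1) * ℓ) ^ d with hDdef
  set s : ℕ := ∑ i, (C i).size with hsdef
  set parB : Fin r → (Fin N → Bool) → Bool :=
    fun i x => decide (((T i).filter fun j => x j = true).card % 2 = 1) with hparB
  -- the error-indicator vector
  set c : (Fin N → Bool) → Fin r → Bool := fun x i => ((C i).eval x != parB i x) with hcdef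
  have hcardΩ : (Fintype.card (Fin N → Bool) : ℝ) = 2 ^ N := by simp
  have hppos : (0 : ℝ) < (p : ℝ) ^ ℓ := by
    have : (0 : ℝ) < p := by exact_mod_cast hp.pos
    positivity
  have hsqrtn : 0 < Real.sqrt n := Real.sqrt_pos.2 (by exact_mod_cast hn)
  -- the two error terms and ε for the XOR lemma
  set u : ℝ := ((r * D : ℕ) : ℝ) / Real.sqrt n with hudef
  set v : ℝ := (s : ℝ) / (p : ℝ) ^ ℓ with hvdef
  have hu : u = (r : ℝ) * (D : ℝ) / Real.sqrt n := by rw [hudef]; push_cast; ring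
  have hu0 : 0 ≤ u := by rw [hudef]; positivity
  have hv0 : 0 ≤ v := by rw [hvdef]; positivity
  set ε : ℝ := 2 * (u + v) with hεdef
  have hε : 0 ≤ ε := by positivity
  -- ### the bias bound for every non-empty `S`
  have hbias : ∀ S : Finset (Fin r), S.Nonempty →
      |∑ x : Fin N → Bool, ∏ i ∈ S, (if c x i then (-1 : ℝ) else 1)| ≤
        ε * Fintype.card (Fin N → Bool) := by
    intro S hS
    rw [hcardΩ]
    -- the `S`-blocks and their total size `m ≥ n ≥ 1`
    set TS : Finset (Fin N) := S.biUnion T with hTS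
    set m : ℕ := TS.card with hmdef
    have hmcard : m = ∑ i ∈ S, (T i).card := by
      rw [hmdef, hTS, Finset.card_biUnion]
      intro i _ j _ hij
      exact hdisj i j hij
    have hmn : n ≤ m := by
      obtain ⟨i₀, hi₀⟩ := hS
      rw [hmcard]
      exact (hTn i₀).trans (Finset.single_le_sum (f := fun i => (T i).card) (fun i _ => Nat.zero_le _) hi₀)
    have hm1 : 1 ≤ m := hn.trans hmn
    have hcompl : TSᶜ.card = N - m := by
      rw [Finset.card_compl, Fintype.card_fin]
    -- the two propositions: XOR of the outputs over `S`, parity of the `S`-blocks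
    set fS : (Fin N → Bool) → Prop :=
      fun x => (S.filter fun i => (C i).eval x = true).card % 2 = 1 with hfS
    set gS : (Fin N → Bool) → Prop :=
      fun x => (TS.filter fun j => x j = true).card % 2 = 1 with hgS
    -- (1) the `±1` statistic is `+1` iff `fS ↔ gS`
    have hstat : ∀ x : Fin N → Bool,
        ∏ i ∈ S, (if c x i then (-1 : ℝ) else 1) = if (fS x ↔ gS x) then 1 else -1 := by
      intro x
      rw [prod_pm_eq_neg_one_pow, neg_one_pow_eq_ite]
      -- parity of the number of errors in `S`
      have herr : (S.filter fun i => c x i = true).card =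
          (S.filter fun i => (C i).eval x ≠ parB i x).card := by
        congr 1
        refine Finset.filter_congr fun i _ => ?_
        simp only [hcdef, bne_iff_ne, ne_eq]
      have h1 := card_filter_ne_mod_two S (fun i => (C i).eval x) (fun i => parB i x)
      have h2 : (S.filter fun i => parB i x = true).card % 2 =
          (∑ i ∈ S, ((T i).filter fun j => x j = true).card) % 2 := by
        rw [← card_filter_odd_mod_two]
        congr 2
        refine Finset.filter_congr fun i _ => ?_
        simp only [hparB, decide_eq_true_eq]
      have h3 : (TS.filter fun j => x j = true).card =
          ∑ i ∈ S, ((T i).filter fun j => x j = true).card := by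
        rw [hTS, Finset.filter_biUnion, Finset.card_biUnion]
        intro i _ j _ hij
        exact Finset.disjoint_filter_filter (hdisj i j hij)
      simp only [hfS, hgS]
      rw [herr]
      by_cases hiff : ((S.filter fun i => (C i).eval x = true).card % 2 = 1 ↔
          (TS.filter fun j => x j = true).card % 2 = 1)
      · rw [if_pos hiff, if_pos]
        rw [h3] at hiff
        have := Nat.mod_two_eq_zero_or_one (S.filter fun i => (C i).eval x = true).card
        omega
      · rw [if_neg hiff, if_neg]
        rw [h3] at hiff
        have := Nat.mod_two_eq_zero_or_one (S.filter fun i => (C i).eval x = true).card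
        omega
    -- (2) the sum of the statistic is `#agree - #disagree`
    have hsumstat : ∑ x : Fin N → Bool, ∏ i ∈ S, (if c x i then (-1 : ℝ) else 1) =
        ((univ.filter fun x => (fS x ↔ gS x)).card : ℝ) -
          ((univ.filter fun x => ¬ (fS x ↔ gS x)).card : ℝ) := by
      rw [Finset.sum_congr rfl fun x _ => hstat x, Finset.sum_ite, Finset.sum_const,
        Finset.sum_const, nsmul_eq_mul, nsmul_eq_mul]
      ring
    have hsplit : ((univ.filter fun x => (fS x ↔ gS x)).card : ℝ) +
        ((univ.filter fun x => ¬ (fS x ↔ gS x)).card : ℝ) = 2 ^ N := by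
      rw [← hcardΩ]
      exact_mod_cast Finset.card_filter_add_card_filter_not (s := univ) (fun x => (fS x ↔ gS x))
    -- (3) agreement and disagreement are both small: postprocess + subset parity
    have hM1 : 1 ≤ (p - 1) * ℓ := Nat.mul_pos (by have := hp.two_le; omega) hℓ
    have hsub_bound : (2 : ℝ) ^ TSᶜ.card * (2 ^ (m - 1) + (r * D) * m.choose (m / 2)) ≤
        2 ^ (N - 1) + 2 ^ N * u := by
      rw [hu, hcompl, mul_add]
      have hpow : (2 : ℝ) ^ (N - m) * 2 ^ (m - 1) = 2 ^ (N - 1) := by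
        rw [← pow_add]; congr 1
        have : m ≤ N := by rw [hmdef]; exact (Finset.card_le_univ _).trans (by simp)
        omega
      rw [hpow]
      refine add_le_add le_rfl ?_
      have hch := choose_half_le_two_pow_div_sqrt hm1
      have hsq : Real.sqrt n ≤ Real.sqrt m := Real.sqrt_le_sqrt (by exact_mod_cast hmn)
      have hmN : m ≤ N := by rw [hmdef]; exact (Finset.card_le_univ _).trans (by simp)
      calc (2 : ℝ) ^ (N - m) * ((r * D) * m.choose (m / 2))
          ≤ 2 ^ (N - m) * ((r * D) * (2 ^ m / Real.sqrt m)) := by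
            refine mul_le_mul_of_nonneg_left (mul_le_mul_of_nonneg_left hch (by positivity))
              (by positivity)
        _ = 2 ^ N * ((r * D) / Real.sqrt m) := by
            rw [show (2 : ℝ) ^ N = 2 ^ (N - m) * 2 ^ m by rw [← pow_add]; congr 1; omega]
            ring
        _ ≤ 2 ^ N * ((r * D) / Real.sqrt n) := by
            refine mul_le_mul_of_nonneg_left ?_ (by positivity)
            exact div_le_div_of_nonneg_left (by positivity) hsqrtn hsq
    have hagree_le : ∀ (agr : (Fin N → Bool) → Prop) (Φ : (Fin r → Bool) → ZMod p),
        (∀ x, (Φ (fun j => (C j).eval x) = if gS x then 1 else 0) ∨ ¬ agr x) →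
        ((univ.filter fun x => agr x).card : ℝ) ≤
          2 ^ (N - 1) + 2 ^ N * u + v * 2 ^ N := by
      intro agr Φ hΦ
      obtain ⟨Q, E, hQ, hE, hQx⟩ :=
        razborov_smolensky_postprocess C hC hd hℓ (RingHom.id (ZMod p)) Φ
      have hsubset : (univ.filter fun x => agr x) ⊆
          (univ.filter fun x => Q x = if (TS.filter fun j => x j = true).card % 2 = 1 then 1 else 0)
            ∪ E := by
        intro x hx
        rw [Finset.mem_filter] at hx
        rw [Finset.mem_union, Finset.mem_filter]
        by_cases hxE : x ∈ E
        · exact Or.inr hxE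
        · refine Or.inl ⟨Finset.mem_univ _, ?_⟩
          rw [hQx x hxE]
          rcases hΦ x with h | h
          · exact h
          · exact absurd hx.2 h
      have hcard := (Finset.card_le_card hsubset).trans (Finset.card_union_le _ _)
      have hpar := paritySubset_agreement_le TS h2F hQ
      have hEr : (E.card : ℝ) ≤ v * 2 ^ N := by
        rw [hvdef, div_mul_eq_mul_div, le_div_iff₀ hppos]
        exact_mod_cast hE
      calc ((univ.filter fun x => agr x).card : ℝ)
          ≤ ((univ.filter fun x =>
              Q x = if (TS.filter fun j => x j = true).card % 2 = 1 then 1 else 0).card : ℝ) +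
              (E.card : ℝ) := by exact_mod_cast hcard
        _ ≤ (2 : ℝ) ^ TSᶜ.card * (2 ^ (m - 1) + (r * D) * m.choose (m / 2)) + (E.card : ℝ) := by
            refine add_le_add ?_ le_rfl
            exact_mod_cast hpar
        _ ≤ 2 ^ (N - 1) + 2 ^ N * u + v * 2 ^ N := add_le_add hsub_bound hEr
    -- apply (3) to agreement (Φ = [XOR]) and to disagreement (Φ = [¬ XOR])
    have hA : ((univ.filter fun x => (fS x ↔ gS x)).card : ℝ) ≤
        2 ^ (N - 1) + 2 ^ N * u + v * 2 ^ N := by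
      convert hagree_le (fun x => (fS x ↔ gS x))
        (fun w => if (S.filter fun i => w i = true).card % 2 = 1 then 1 else 0) (fun x => by
        by_cases h : (fS x ↔ gS x)
        · left
          simp only [hfS] at h
          by_cases hg : gS x
          · rw [if_pos (h.2 hg), if_pos hg]
          · rw [if_neg (fun h' => hg (h.1 h')), if_neg hg]
        · right; exact h)
    have hB : ((univ.filter fun x => ¬ (fS x ↔ gS x)).card : ℝ) ≤
        2 ^ (N - 1) + 2 ^ N * u + v * 2 ^ N := by
      convert hagree_le (fun x => ¬ (fS x ↔ gS x))
        (fun w => if (S.filter fun i => w i = true).card % 2 = 1 then 0 else 1) (fun x => by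
        by_cases h : (fS x ↔ gS x)
        · right; exact not_not_intro h
        · left
          simp only [hfS] at h
          by_cases hg : gS x
          · rw [if_neg (fun h' => h ⟨fun _ => hg, fun _ => h'⟩), if_pos hg]
          · rw [if_pos (by
              by_contra h'
              exact h ⟨fun hf => absurd hf h', fun hg' => absurd hg' hg⟩), if_neg hg])
    -- (4) conclude the bias bound
    rw [hsumstat]
    have h2N : (2 : ℝ) ^ N = 2 * 2 ^ (N - 1) := by
      have hN1 : 1 ≤ N := hm1.trans (by rw [hmdef]; exact (Finset.card_le_univ _).trans (by simp))
      rw [← pow_succ']; congr 1; omega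
    have hM : 2 * (2 ^ (N - 1) + 2 ^ N * u + v * 2 ^ N) - (2 : ℝ) ^ N = ε * 2 ^ N := by
      rw [hεdef, h2N]; ring
    rw [abs_le]
    constructor
    · have h1 : (2 : ℝ) ^ N - 2 * (2 ^ (N - 1) + 2 ^ N * u + v * 2 ^ N) ≤
          ((univ.filter fun x => (fS x ↔ gS x)).card : ℝ) -
            ((univ.filter fun x => ¬ (fS x ↔ gS x)).card : ℝ) := by linarith
      linarith
    · have h1 : ((univ.filter fun x => (fS x ↔ gS x)).card : ℝ) -
            ((univ.filter fun x => ¬ (fS x ↔ gS x)).card : ℝ) ≤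
          2 * (2 ^ (N - 1) + 2 ^ N * u + v * 2 ^ N) - (2 : ℝ) ^ N := by linarith
      linarith
  -- ### the XOR lemma with Hoeffding
  have hmain := XorLemma.card_many_correct_le c hε hγ hbias
  rw [hcardΩ] at hmain
  have hevt : (univ.filter fun x : Fin N → Bool =>
      (1 / 2 + γ) * r ≤ ((univ.filter fun i : Fin r =>
        (C i).eval x = decide (((T i).filter fun j => x j = true).card % 2 = 1)).card : ℝ)) =
      univ.filter fun x : Fin N → Bool =>
        (1 / 2 + γ) * r ≤ ((univ.filter fun i : Fin r => c x i = false).card : ℝ) := by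
    refine Finset.filter_congr fun x _ => ?_
    have hc' : (univ.filter fun i : Fin r =>
        (C i).eval x = decide (((T i).filter fun j => x j = true).card % 2 = 1)) =
        univ.filter fun i : Fin r => c x i = false := by
      refine Finset.filter_congr fun i _ => ?_
      simp only [hcdef, hparB, bne_eq_false_iff_eq]
    rw [hc']
  rw [hevt]
  refine hmain.trans (le_of_eq ?_)
  rw [hεdef]
  ring

end Smolensky

end Literature.Computability.MetaComplexity
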